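import Literature.Geometry.ComplexHyperbolic.UnitBallBounds        -- ★ `U21`, `mat`, `J`, `mat_inv` (`g⁻¹ = J gᴴ J`), `row_identity`, `col_identity`, `smul_x₀_val`, `one_sub_nsq_smul_x₀`, `lift`
import HarnessLib

/-!
# Hilbert–Schmidt radius of a conjugate `g⁻¹ γ g` in `U(2,1)` as an explicit function of the ball point `g · 0` — identity (I1) of brick (H′-ball)

Topic `NumberTheory/Rogawski1990`; namespace `Literature.NumberTheory.Rogawski1990`.  THEOREMS ONLY (no definition, no instance, no notation, no axiom, no named fact,
no `sorry`).  Cell `pub/hodgecm-mathlib`, crux H413 (`stmt-HodgeConjecture-24833`), F0∕P3c line LH2 (closer stub `stub_N8`; letters O1″∕O3″ about `𝒞(G_∞) = ArchSchwartzOn L 3 Φ₃ 1`,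
`G_∞ ≅ U(2,1)^d`); seat LH2-p03 (g3), brick (H′-ball) of LH2-plan (g0) (GO 2026-09-02T04:28:48Z, condition (1): «(I1) FIRST, ALONE, IN THE KERNEL»).  (VOL)-kit, count-neutral.

THE IDENTITY.  In the tree's ball model `U21 = {g ∈ GL₃(ℂ) ∣ gᴴ J g = J}`, `J = diag(1,1,−1)` (★ `Literature/Geometry/ComplexHyperbolic/UnitBallU21`), for ALL `g, γ ∈ U21`:
  **`Σ_{i,j} |(g⁻¹ γ g)_{ij}|² = 4 · |Σ_{i,j} \overline{g_{i2}} · J_{ii} · γ_{ij} · g_{j2}|² − 1`**      (`hs_inv_conj_eq`),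
i.e. the squared Hilbert–Schmidt norm of the conjugate is an explicit quadratic function of the LAST COLUMN `col₂(g) = g_{22} · (z₀, z₁, 1)`, `z = g · 0 ∈ 𝔹²`
(★ `smul_x₀_val`), `|g_{22}|² = (1 − |z|²)⁻¹` (★ `one_sub_nsq_smul_x₀`):
  **`Σ_{i,j} |(g⁻¹ γ g)_{ij}|² = 4 · |Σ_{i,j} \overline{ẑ_i} · J_{ii} · γ_{ij} · ẑ_j|² ∕ (1 − |z|²)² − 1`**,  `ẑ = (z₀, z₁, 1)` = ★ `lift z`      (`hs_inv_conj_eq_ball`).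
Consequently the orbit HS-ball `{g ∣ Σ|(g⁻¹ γ g)_{ij}|² ≤ R}` is RIGHT-`K`-invariant (`K = Stab(0) = U(2) × U(1)`) and is the orbit-map preimage of an explicit subset of
`𝔹²` — the entry point of the ball-model road to Harish-Chandra's orbit-volume growth at the HYPERBOLIC regular classes of `U(2,1)` (brick (H′-ball); sequel file
`ArchHyperbolicOrbitMeasureThree`), where the Haar measure of right-`K`-invariant sets is the Bergman volume (★ `map_orbit_haar_eq_smul_bergmanVolume`).

PROOF.  (a) `g⁻¹ γ g ∈ U21`, and on `U21` the squared HS norm is `4|m_{22}|² − 1` (`hs_eq_four_mul_norm_sq_sub_one`: sum the three column identities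
`|m_{0j}|² + |m_{1j}|² − |m_{2j}|² = J_{jj}` and the row identity `|m_{20}|² + |m_{21}|² − |m_{22}|² = −1`, ★ `col_identity`, ★ `row_identity`); (b) `g⁻¹ = J gᴴ J` (★ `mat_inv`)
gives `(g⁻¹ γ g)_{22} = −Σ_{i,j} \overline{g_{i2}} J_{ii} γ_{ij} g_{j2}` (`inv_mul_mul_apply_two_two`); (c) `g_{i2} = g_{22} ẑ_i` (★ `smul_x₀_val`).  No case analysis on `γ`:
the identity holds for every `γ ∈ U21` (at `g = 1`: `Σ|γ_{ij}|² = 4|γ_{22}|² − 1`, the remark in ★ `ArchUnitaryThreeHaarHSBall`).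
[cite: BeuzartPlessis2020Asterisque, §1.2 pp. 19–21 (norms on `G` and on `X = H\G`)] [cite: Rudin1980, §2.2 Thm. 2.2.2 (`1 − |g·0|² = |g_{22}|⁻²`)]

HONEST LABEL: HC_CM is proved only modulo the 7 printed citations (2 remaining: hLiu418 = `stmt-HodgeConjecture-24832`, h413 = `stmt-HodgeConjecture-24833`) until rung 0
closes; this file is (VOL)-kit under the letters O1″∕O3″ of `stub_N8` (count-neutral, +0∕+0) and pays no printed row.

## References
* [BeuzartPlessis2020Asterisque] R. Beuzart-Plessis, *A local trace formula for the Gan–Gross–Prasad conjecture for unitary groups: the archimedean case*,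
  Astérisque 418 (2020), §1.2 pp. 19–21 (norms and orbit norms), §1.8 p. 39.
* [Rudin1980] W. Rudin, *Function Theory in the Unit Ball of ℂⁿ*, Grundlehren 241 (1980), §2.2 (automorphisms of the ball; Thm. 2.2.2).
* [Rogawski1990] J. D. Rogawski, *Automorphic Representations of Unitary Groups in Three Variables*, Ann. of Math. Stud. 123 (1990), §3.6 p. 31 (Cartan subgroups of `U(2,1)`),
  §14.2 (14.2.1) p. 232.
-/

set_option autoImplicit false

noncomputable section

open Matrix Complex ComplexConjugate
open Literature.Geometry.ComplexHyperbolic Literature.Geometry.ComplexHyperbolic.BallModel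

namespace Literature.NumberTheory.Rogawski1990

/-! ## §1 The squared Hilbert–Schmidt norm on `U(2,1)` is `4|m₂₂|² − 1` -/

/-- **On `U(2,1)` (ball model `U21`, `J = diag(1,1,−1)`): `Σ_{i,j} |m_{ij}|² = 4|m_{22}|² − 1`.**  Sum the column identities `|m_{0j}|² + |m_{1j}|² − |m_{2j}|² = J_{jj}` over
`j` and use the row identity `|m_{20}|² + |m_{21}|² − |m_{22}|² = −1` (★ `col_identity`, ★ `row_identity`). [cite: BeuzartPlessis2020Asterisque, §1.2 pp. 19–21] -/
theorem hs_eq_four_mul_norm_sq_sub_one (m : U21) :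
    ∑ i : Fin 3, ∑ j : Fin 3, ‖mat m i j‖ ^ 2 = 4 * ‖mat m 2 2‖ ^ 2 - 1 := by
  have c0 := col_identity m 0
  have c1 := col_identity m 1
  have c2 := col_identity m 2
  have r2 := row_identity m 2
  simp only [Fin.isValue, Fin.reduceEq, if_false, if_true] at c0 c1 c2 r2
  simp only [Fin.sum_univ_three]
  linarith

/-! ## §2 The corner entry of `g⁻¹ γ g` -/

/-- `J` is diagonal: `J i j = 0` for `i ≠ j`, and `J i i ∈ {1, 1, −1}`; packaged as `J = diagonal ![1,1,−1]` evaluated. [folklore] -/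
private theorem J_apply (i j : Fin 3) : J i j = if i = j then (![1, 1, -1] : Fin 3 → ℂ) i else 0 := by
  rw [BallModel.J, Matrix.diagonal_apply]

/-- **`(g⁻¹ γ g)_{22} = −Σ_{i,j} \overline{g_{i2}} · J_{ii} · γ_{ij} · g_{j2}`** for `g, γ ∈ U21` (`g⁻¹ = J gᴴ J`, ★ `mat_inv`; `J_{22} = −1`).
[cite: Rudin1980, §2.2] -/
theorem inv_mul_mul_apply_two_two (g γ : U21) :
    mat (g⁻¹ * γ * g) 2 2 = -∑ i : Fin 3, ∑ j : Fin 3, star (mat g i 2) * J i i * mat γ i j * mat g j 2 := by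
  rw [mat_mul, mat_mul, mat_inv]
  simp only [Matrix.mul_apply, Fin.sum_univ_three, J_apply, conjTranspose_apply]
  simp only [Fin.isValue, Fin.reduceEq, if_true, if_false, Matrix.cons_val_zero, Matrix.cons_val_one, Matrix.cons_val_two,
    Matrix.tail_cons, Matrix.head_cons]
  ring

/-! ## §3 (I1): the HS radius of `g⁻¹ γ g` through the last column of `g`, and through `z = g · 0` -/

/-- **(I1) `Σ_{i,j} |(g⁻¹ γ g)_{ij}|² = 4 · |Σ_{i,j} \overline{g_{i2}} J_{ii} γ_{ij} g_{j2}|² − 1` for all `g, γ ∈ U(2,1)`** (ball model `U21`): §1 at `m = g⁻¹ γ g ∈ U21` and §2.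
The right-hand side depends on `g` only through its last column, i.e. through `z = g · 0` and `|g_{22}|` — the set `{g ∣ HS²(g⁻¹γg) ≤ R}` is right-`K`-invariant.
[cite: BeuzartPlessis2020Asterisque, §1.2 pp. 19–21] [cite: Rudin1980, §2.2 Thm. 2.2.2] -/
theorem hs_inv_conj_eq (g γ : U21) :
    ∑ i : Fin 3, ∑ j : Fin 3, ‖mat (g⁻¹ * γ * g) i j‖ ^ 2 =
      4 * ‖∑ i : Fin 3, ∑ j : Fin 3, star (mat g i 2) * J i i * mat γ i j * mat g j 2‖ ^ 2 - 1 := by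
  rw [hs_eq_four_mul_norm_sq_sub_one, inv_mul_mul_apply_two_two, norm_neg]

/-- The last column of `g` is `g_{22} · ẑ`, `ẑ = lift (g · 0) = (z₀, z₁, 1)` (★ `smul_x₀_val`). [cite: Rudin1980, §2.2 Thm. 2.2.2] -/
theorem mat_apply_two_eq_mul_lift (g : U21) (i : Fin 3) : mat g i 2 = mat g 2 2 * lift (g • x₀) i := by
  have h22 : mat g 2 2 ≠ 0 := norm_pos_iff.1 (norm_22_pos g)
  fin_cases i
  · show mat g 0 2 = mat g 2 2 * lift (g • x₀) 0
    rw [lift_0, smul_x₀_val]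
    show mat g 0 2 = mat g 2 2 * (mat g 0 2 / mat g 2 2)
    field_simp
  · show mat g 1 2 = mat g 2 2 * lift (g • x₀) 1
    rw [lift_1, smul_x₀_val]
    show mat g 1 2 = mat g 2 2 * (mat g 1 2 / mat g 2 2)
    field_simp
  · show mat g 2 2 = mat g 2 2 * lift (g • x₀) 2
    rw [lift_2, mul_one]

/-- The quadratic form of the last column is `|g_{22}|²` times that of `ẑ`: `Σ \overline{g_{i2}} J_{ii} γ_{ij} g_{j2} = |g_{22}|² · Σ \overline{ẑ_i} J_{ii} γ_{ij} ẑ_j`.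
[cite: Rudin1980, §2.2 Thm. 2.2.2] -/
theorem sum_col_two_eq_norm_sq_mul_sum_lift (g γ : U21) :
    ∑ i : Fin 3, ∑ j : Fin 3, star (mat g i 2) * J i i * mat γ i j * mat g j 2 =
      ((‖mat g 2 2‖ ^ 2 : ℝ) : ℂ) * ∑ i : Fin 3, ∑ j : Fin 3, star (lift (g • x₀) i) * J i i * mat γ i j * lift (g • x₀) j := by
  have hn : ((‖mat g 2 2‖ ^ 2 : ℝ) : ℂ) = star (mat g 2 2) * mat g 2 2 := by
    rw [Complex.star_def, Complex.conj_mul' (mat g 2 2)]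
    push_cast
    ring
  rw [hn, Finset.mul_sum]
  refine Finset.sum_congr rfl fun i _ => ?_
  rw [Finset.mul_sum]
  refine Finset.sum_congr rfl fun j _ => ?_
  rw [mat_apply_two_eq_mul_lift g i, mat_apply_two_eq_mul_lift g j, star_mul]
  ring

/-- **(I1) in ball coordinates: `Σ_{i,j} |(g⁻¹ γ g)_{ij}|² = 4 · |Σ_{i,j} \overline{ẑ_i} J_{ii} γ_{ij} ẑ_j|² ∕ (1 − |z|²)² − 1`**, `z = g · 0`, `ẑ = (z₀, z₁, 1)`
(`|g_{22}|² = (1 − |z|²)⁻¹`, ★ `one_sub_nsq_smul_x₀`).  The orbit HS-ball `{g ∣ HS²(g⁻¹ γ g) ≤ R}` is the orbit-map preimage of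
`{z ∈ 𝔹² ∣ 4|Σ \overline{ẑ_i} J_{ii} γ_{ij} ẑ_j|² ≤ (R + 1)(1 − |z|²)²}`. [cite: BeuzartPlessis2020Asterisque, §1.2 pp. 19–21] [cite: Rudin1980, §2.2 Thm. 2.2.2] -/
theorem hs_inv_conj_eq_ball (g γ : U21) :
    ∑ i : Fin 3, ∑ j : Fin 3, ‖mat (g⁻¹ * γ * g) i j‖ ^ 2 =
      4 * ‖∑ i : Fin 3, ∑ j : Fin 3, star (lift (g • x₀) i) * J i i * mat γ i j * lift (g • x₀) j‖ ^ 2 / (1 - nsq (g • x₀).1) ^ 2 - 1 := by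
  rw [hs_inv_conj_eq, sum_col_two_eq_norm_sq_mul_sum_lift, norm_mul, one_sub_nsq_smul_x₀, mul_pow]
  have hpos : 0 < ‖mat g 2 2‖ ^ 2 := pow_pos (norm_22_pos g) 2
  have hn : ‖((‖mat g 2 2‖ ^ 2 : ℝ) : ℂ)‖ = ‖mat g 2 2‖ ^ 2 := by
    rw [Complex.norm_real, Real.norm_eq_abs, abs_of_pos hpos]
  rw [hn]
  field_simp

/-- **The orbit HS-ball read on the ball**: `HS²(g⁻¹ γ g) ≤ R ⟺ 4|Σ \overline{ẑ_i} J_{ii} γ_{ij} ẑ_j|² ≤ (R + 1)(1 − |z|²)²`, `z = g · 0`.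
[cite: BeuzartPlessis2020Asterisque, §1.2 pp. 19–21] [cite: Rudin1980, §2.2 Thm. 2.2.2] -/
theorem hs_inv_conj_le_iff (g γ : U21) (R : ℝ) :
    ∑ i : Fin 3, ∑ j : Fin 3, ‖mat (g⁻¹ * γ * g) i j‖ ^ 2 ≤ R ↔
      4 * ‖∑ i : Fin 3, ∑ j : Fin 3, star (lift (g • x₀) i) * J i i * mat γ i j * lift (g • x₀) j‖ ^ 2 ≤ (R + 1) * (1 - nsq (g • x₀).1) ^ 2 := by
  rw [hs_inv_conj_eq_ball]
  have hpos : 0 < (1 - nsq (g • x₀).1) ^ 2 := by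
    have := (g • x₀).2
    have h1 : 0 < 1 - nsq (g • x₀).1 := by linarith
    positivity
  rw [sub_le_iff_le_add, div_le_iff₀ hpos]

end Literature.NumberTheory.Rogawski1990

end
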